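import Literature.MathematicalPhysics.QuantumManyBody.GroundStateFeynmanKacFreeForm
import Mathlib.Analysis.Calculus.BumpFunction.InnerProduct
import HarnessLib

/-!
# Smooth symmetric pair-collision cutoffs on `N`-particle configuration space

Topic `Literature/MathematicalPhysics/QuantumManyBody` (Bose gas, namespace `BoseGas.PairCutoff`).
The standard smooth cutoff of a neighbourhood of the collision set `{xᵢ = xⱼ} ⊂ (ℝ³)^N` used to
compare Dirichlet forms of pair potentials that differ only near the origin (hard-core / truncation
arguments, cf. [LSSY2005, Ch. 2]): for a radial bump `f : ContDiffBump (0 : ℝ³)` (`= 1` on the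
closed ball of radius `f.rIn`, `= 0` off the ball of radius `f.rOut`, values in `[0,1]`, smooth,
compact support) and a profile `θ : ℝ → ℝ`, the pair sum `s(X) = ∑_{i ≠ j} f((xᵢ - xⱼ)/ε) ∈ [0, N²]`
is permutation symmetric, `≥ 1` as soon as some pair is `ε rIn`-close and `= 0` when all pairs are
`ε rOut`-separated; the cutoff `θ ∘ s` is `C¹` with the chain-rule derivative, the **uniform
gradient bound** `‖D(θ ∘ s)(X)‖ ≤ K N² M (2/ε)` (`|θ'| ≤ K` on `[0, N²]`, `‖Df‖ ≤ M`), and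
`D(θ ∘ s)(X) = 0` when all pairs are strictly `ε rOut`-separated. Also `|∇φ|² ≤ 3N ‖Dφ‖²` for the
real kinetic density `realKinetic`. Everything is stated for the explicit expressions (no auxiliary
definitions). Not here: the volume of the exceptional set `{∃ i ≠ j, |xᵢ - xⱼ| < r} ∩ Λ^N`
(codimension three) and any specific choice of `θ`, `f`.

## References

* [LSSY2005] E. H. Lieb, R. Seiringer, J. P. Solovej, J. Yngvason, *The Mathematics of the Bose
  Gas and its Condensation* (2005), Ch. 2 (softening of hard-core/singular pair potentials near
  the collision set). The estimates themselves are elementary calculus. [folklore]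
-/

noncomputable section

open MeasureTheory Filter Set Metric
open scoped ENNReal NNReal Topology

namespace Literature.MathematicalPhysics.QuantumManyBody.BoseGas
open ContinuousLinearMap (proj)

namespace PairCutoff

variable {N : ℕ}

/-! ### Radial bumps and the scaled pair difference -/

/-- The derivative of a bump `f` vanishes off the closed ball of radius `f.rOut`. [folklore] -/
theorem fderiv_bump_eq_zero (f : ContDiffBump (0 : Space)) {y : Space} (h : f.rOut < ‖y‖) :
    fderiv ℝ f y = 0 := by
  refine fderiv_of_notMem_tsupport ℝ ?_
  rw [f.tsupport_eq, mem_closedBall, dist_zero_right, not_le]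
  exact h

/-- `‖Df‖` is bounded for a bump `f` (continuous with compact support). [folklore] -/
theorem exists_bound_fderiv_bump (f : ContDiffBump (0 : Space)) :
    ∃ M : ℝ, 0 ≤ M ∧ ∀ y, ‖fderiv ℝ f y‖ ≤ M := by
  obtain ⟨M, hM⟩ := (f.hasCompactSupport.fderiv ℝ).exists_bound_of_continuous
    ((f.contDiff (n := 1)).continuous_fderiv one_ne_zero)
  exact ⟨M, (norm_nonneg _).trans (hM 0), hM⟩

/-- `‖ε⁻¹ (x - y)‖ = |x - y| / ε`. [folklore] -/
theorem norm_inv_smul_sub {ε : ℝ} (hε : 0 < ε) (x y : Space) :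
    ‖ε⁻¹ • (x - y)‖ = dist x y / ε := by
  rw [norm_smul, Real.norm_eq_abs, abs_of_pos (inv_pos.2 hε), dist_eq_norm, div_eq_inv_mul]

/-- The scaled pair difference `Y ↦ ε⁻¹ (yᵢ - yⱼ)` has derivative `ε⁻¹ (prᵢ - prⱼ)`. [folklore] -/
theorem hasFDerivAt_pairDiff (ε : ℝ) (i j : Fin N) (X : Config N) :
    HasFDerivAt (fun Y : Config N => ε⁻¹ • (Y i - Y j))
      (ε⁻¹ • ((proj i : Config N →L[ℝ] Space) - proj j)) X :=
  ((hasFDerivAt_apply i X).sub (hasFDerivAt_apply j X)).const_smul ε⁻¹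

/-- `‖ε⁻¹ (prᵢ - prⱼ)‖ ≤ 2/ε`. [folklore] -/
theorem norm_pairDiff_le {ε : ℝ} (hε : 0 < ε) (i j : Fin N) :
    ‖(ε⁻¹ • ((proj i : Config N →L[ℝ] Space) - proj j))‖ ≤ 2 / ε := by
  refine ContinuousLinearMap.opNorm_le_bound _ (by positivity) fun v => ?_
  show ‖ε⁻¹ • (v i - v j)‖ ≤ 2 / ε * ‖v‖
  rw [norm_smul, Real.norm_eq_abs, abs_of_pos (inv_pos.2 hε)]
  have h1 := norm_le_pi_norm v i
  have h2 := norm_le_pi_norm v j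
  have h3 : ‖v i - v j‖ ≤ ‖v i‖ + ‖v j‖ := norm_sub_le _ _
  rw [div_eq_mul_inv, mul_comm (2 : ℝ), mul_assoc]
  exact mul_le_mul_of_nonneg_left (by linarith) (inv_pos.2 hε).le

/-! ### The pair sum `s(X) = ∑_{i ≠ j} f((xᵢ - xⱼ)/ε)` -/

/-- Each pair term lies in `[0, 1]`. [folklore] -/
theorem pairTerm_mem (f : ContDiffBump (0 : Space)) (ε : ℝ) (i j : Fin N) (X : Config N) :
    0 ≤ (if i = j then (0 : ℝ) else f (ε⁻¹ • (X i - X j))) ∧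
      (if i = j then (0 : ℝ) else f (ε⁻¹ • (X i - X j))) ≤ 1 := by
  split_ifs
  · exact ⟨le_rfl, zero_le_one⟩
  · exact ⟨f.nonneg, f.le_one⟩

/-- The pair sum lies in `[0, N²]`. [folklore] -/
theorem pairSum_mem (f : ContDiffBump (0 : Space)) (ε : ℝ) (X : Config N) :
    0 ≤ (∑ i, ∑ j, if i = j then (0 : ℝ) else f (ε⁻¹ • (X i - X j))) ∧
      (∑ i, ∑ j, if i = j then (0 : ℝ) else f (ε⁻¹ • (X i - X j))) ≤ (N : ℝ) * N := by
  refine ⟨Finset.sum_nonneg fun i _ => Finset.sum_nonneg fun j _ => (pairTerm_mem f ε i j X).1,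
    ?_⟩
  calc (∑ i, ∑ j, if i = j then (0 : ℝ) else f (ε⁻¹ • (X i - X j)))
      ≤ ∑ _i : Fin N, ∑ _j : Fin N, (1 : ℝ) :=
        Finset.sum_le_sum fun i _ => Finset.sum_le_sum fun j _ => (pairTerm_mem f ε i j X).2
    _ = (N : ℝ) * N := by simp

/-- The pair sum is symmetric under permutations of the particles. [folklore] -/
theorem pairSum_comp_perm (f : ContDiffBump (0 : Space)) (ε : ℝ) (σ : Equiv.Perm (Fin N))
    (X : Config N) :
    (∑ i, ∑ j, if i = j then (0 : ℝ) else f (ε⁻¹ • (X (σ i) - X (σ j)))) =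
      ∑ i, ∑ j, if i = j then (0 : ℝ) else f (ε⁻¹ • (X i - X j)) := by
  set F : Fin N → Fin N → ℝ := fun a b => if a = b then 0 else f (ε⁻¹ • (X a - X b)) with hF
  have h1 : ∀ i j, (if i = j then (0 : ℝ) else f (ε⁻¹ • (X (σ i) - X (σ j)))) = F (σ i) (σ j) :=
    fun i j => by simp only [hF, σ.injective.eq_iff]
  simp_rw [h1]
  calc ∑ i, ∑ j, F (σ i) (σ j) = ∑ a, ∑ j, F a (σ j) :=
        Fintype.sum_equiv σ _ _ fun i => rfl
    _ = ∑ a, ∑ b, F a b :=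
        Finset.sum_congr rfl fun a _ => Fintype.sum_equiv σ _ _ fun j => rfl

/-- The pair sum is `≥ 1` as soon as some pair is `ε rIn`-close. [folklore] -/
theorem one_le_pairSum (f : ContDiffBump (0 : Space)) {ε : ℝ} (hε : 0 < ε) {X : Config N}
    (h : ∃ i j : Fin N, i ≠ j ∧ dist (X i) (X j) ≤ ε * f.rIn) :
    1 ≤ ∑ i, ∑ j, if i = j then (0 : ℝ) else f (ε⁻¹ • (X i - X j)) := by
  obtain ⟨i, j, hij, hd⟩ := h
  have hterm : (if i = j then (0 : ℝ) else f (ε⁻¹ • (X i - X j))) = 1 := by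
    rw [if_neg hij]
    refine f.one_of_mem_closedBall ?_
    rw [mem_closedBall, dist_zero_right, norm_inv_smul_sub hε, div_le_iff₀ hε, mul_comm]
    exact hd
  calc (1 : ℝ) = (if i = j then (0 : ℝ) else f (ε⁻¹ • (X i - X j))) := hterm.symm
    _ ≤ ∑ j', if i = j' then (0 : ℝ) else f (ε⁻¹ • (X i - X j')) :=
        Finset.single_le_sum (fun j' _ => (pairTerm_mem f ε i j' X).1) (Finset.mem_univ j)
    _ ≤ ∑ i', ∑ j', if i' = j' then (0 : ℝ) else f (ε⁻¹ • (X i' - X j')) :=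
        Finset.single_le_sum
          (fun i' _ => Finset.sum_nonneg fun j' _ => (pairTerm_mem f ε i' j' X).1)
          (Finset.mem_univ i)

/-- The pair sum vanishes when all pairs are `ε rOut`-separated. [folklore] -/
theorem pairSum_eq_zero (f : ContDiffBump (0 : Space)) {ε : ℝ} (hε : 0 < ε) {X : Config N}
    (h : ∀ i j : Fin N, i ≠ j → ε * f.rOut ≤ dist (X i) (X j)) :
    (∑ i, ∑ j, if i = j then (0 : ℝ) else f (ε⁻¹ • (X i - X j))) = 0 := by
  refine Finset.sum_eq_zero fun i _ => Finset.sum_eq_zero fun j _ => ?_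
  split_ifs with hij
  · rfl
  · refine f.zero_of_le_dist ?_
    rw [dist_zero_right, norm_inv_smul_sub hε, le_div_iff₀ hε, mul_comm]
    exact h i j hij

/-! ### The cutoff `θ ∘ s` and its derivative -/

/-- The cutoff `θ ∘ s` is `C¹` for `C¹` profile `θ`. [folklore] -/
theorem cutoff_contDiff {θ : ℝ → ℝ} (hθ : ContDiff ℝ 1 θ) (f : ContDiffBump (0 : Space)) (ε : ℝ) :
    ContDiff ℝ 1 fun Y : Config N =>
      θ (∑ i, ∑ j, if i = j then (0 : ℝ) else f (ε⁻¹ • (Y i - Y j))) := by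
  refine hθ.comp (ContDiff.sum fun i _ => ContDiff.sum fun j _ => ?_)
  by_cases h : i = j
  · simp only [h, if_true]
    exact contDiff_const
  · simp only [h, if_false]
    exact (f.contDiff (n := 1)).comp
      (((contDiff_apply ℝ Space i).sub (contDiff_apply ℝ Space j)).const_smul ε⁻¹)

/-- Chain rule for one pair term. [folklore] -/
theorem hasFDerivAt_pairTerm (f : ContDiffBump (0 : Space)) (ε : ℝ) (i j : Fin N) (X : Config N) :
    HasFDerivAt (fun Y : Config N => if i = j then (0 : ℝ) else f (ε⁻¹ • (Y i - Y j)))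
      (if i = j then (0 : Config N →L[ℝ] ℝ) else
        (fderiv ℝ f (ε⁻¹ • (X i - X j))).comp
          (ε⁻¹ • ((proj i : Config N →L[ℝ] Space) - proj j))) X := by
  by_cases h : i = j
  · simp only [h, if_true]
    exact hasFDerivAt_const 0 X
  · simp only [h, if_false]
    exact ((f.contDiff (n := 1)).differentiable one_ne_zero _).hasFDerivAt.comp X
      (hasFDerivAt_pairDiff ε i j X)

/-- Chain rule for the cutoff: `D(θ ∘ s)(X) = θ'(s X) • Ds(X)`. [folklore] -/
theorem hasFDerivAt_cutoff {θ : ℝ → ℝ} (hθ : Differentiable ℝ θ) (f : ContDiffBump (0 : Space))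
    (ε : ℝ) (X : Config N) :
    HasFDerivAt (fun Y : Config N =>
        θ (∑ i, ∑ j, if i = j then (0 : ℝ) else f (ε⁻¹ • (Y i - Y j))))
      (deriv θ (∑ i, ∑ j, if i = j then (0 : ℝ) else f (ε⁻¹ • (X i - X j))) •
        ∑ i, ∑ j, if i = j then (0 : Config N →L[ℝ] ℝ) else
          (fderiv ℝ f (ε⁻¹ • (X i - X j))).comp
            (ε⁻¹ • ((proj i : Config N →L[ℝ] Space) - proj j))) X :=
  (hθ _).hasDerivAt.comp_hasFDerivAt X
    (HasFDerivAt.fun_sum fun i _ => HasFDerivAt.fun_sum fun j _ => hasFDerivAt_pairTerm f ε i j X)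

/-- **Uniform gradient bound** `‖D(θ ∘ s)(X)‖ ≤ K · N² · M · (2/ε)` from `|θ'| ≤ K` on `[0, N²]`
and `‖Df‖ ≤ M`. [folklore] -/
theorem norm_fderiv_cutoff_le {θ : ℝ → ℝ} (hθ : Differentiable ℝ θ) {K : ℝ} (hK0 : 0 ≤ K)
    (hK : ∀ t ∈ Icc (0 : ℝ) (N * N), ‖deriv θ t‖ ≤ K) (f : ContDiffBump (0 : Space)) {M : ℝ}
    (hM0 : 0 ≤ M) (hM : ∀ y, ‖fderiv ℝ f y‖ ≤ M) {ε : ℝ} (hε : 0 < ε) (X : Config N) :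
    ‖fderiv ℝ (fun Y : Config N =>
        θ (∑ i, ∑ j, if i = j then (0 : ℝ) else f (ε⁻¹ • (Y i - Y j)))) X‖ ≤
      K * ((N : ℝ) * N * (M * (2 / ε))) := by
  rw [(hasFDerivAt_cutoff hθ f ε X).fderiv, norm_smul]
  set D : Fin N → Fin N → Config N →L[ℝ] ℝ := fun i j => if i = j then 0 else
    (fderiv ℝ f (ε⁻¹ • (X i - X j))).comp (ε⁻¹ • ((proj i : Config N →L[ℝ] Space) - proj j)) with hD
  have h1 : ‖deriv θ (∑ i, ∑ j, if i = j then (0 : ℝ) else f (ε⁻¹ • (X i - X j)))‖ ≤ K :=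
    hK _ ⟨(pairSum_mem f ε X).1, (pairSum_mem f ε X).2⟩
  have hDle : ∀ i j, ‖D i j‖ ≤ M * (2 / ε) := by
    intro i j
    simp only [hD]
    split_ifs
    · rw [norm_zero]
      positivity
    · exact (ContinuousLinearMap.opNorm_comp_le _ _).trans
        (mul_le_mul (hM _) (norm_pairDiff_le hε i j) (norm_nonneg _) hM0)
  have h2 : ‖∑ i, ∑ j, D i j‖ ≤ (N : ℝ) * N * (M * (2 / ε)) := by
    calc ‖∑ i, ∑ j, D i j‖ ≤ ∑ i, ‖∑ j, D i j‖ := norm_sum_le _ _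
      _ ≤ ∑ i, ∑ j, ‖D i j‖ := Finset.sum_le_sum fun i _ => norm_sum_le _ _
      _ ≤ ∑ _i : Fin N, ∑ _j : Fin N, M * (2 / ε) :=
          Finset.sum_le_sum fun i _ => Finset.sum_le_sum fun j _ => hDle i j
      _ = (N : ℝ) * N * (M * (2 / ε)) := by
          simp only [Finset.sum_const, Finset.card_univ, Fintype.card_fin, nsmul_eq_mul]
          ring
  exact mul_le_mul h1 h2 (norm_nonneg _) hK0

/-- Off the exceptional set the derivative of the cutoff vanishes: if all pairs are strictly
`ε rOut`-separated then `D(θ ∘ s)(X) = 0` (each `Df((xᵢ - xⱼ)/ε)` vanishes). [folklore] -/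
theorem fderiv_cutoff_eq_zero {θ : ℝ → ℝ} (hθ : Differentiable ℝ θ) (f : ContDiffBump (0 : Space))
    {ε : ℝ} (hε : 0 < ε) {X : Config N}
    (h : ∀ i j : Fin N, i ≠ j → ε * f.rOut < dist (X i) (X j)) :
    fderiv ℝ (fun Y : Config N =>
        θ (∑ i, ∑ j, if i = j then (0 : ℝ) else f (ε⁻¹ • (Y i - Y j)))) X = 0 := by
  rw [(hasFDerivAt_cutoff hθ f ε X).fderiv]
  have hD : ∀ i j : Fin N, (if i = j then (0 : Config N →L[ℝ] ℝ) else
      (fderiv ℝ f (ε⁻¹ • (X i - X j))).comp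
        (ε⁻¹ • ((proj i : Config N →L[ℝ] Space) - proj j))) = 0 := by
    intro i j
    split_ifs with hij
    · rfl
    · rw [fderiv_bump_eq_zero f, ContinuousLinearMap.zero_comp]
      rw [norm_inv_smul_sub hε, lt_div_iff₀ hε, mul_comm]
      exact h i j hij
  simp only [hD, Finset.sum_const_zero, smul_zero]

/-! ### The real kinetic density against the operator norm -/

/-- `|∇φ(X)|² ≤ 3N B²` whenever `‖Dφ(X)‖ ≤ B` (each of the `3N` partial derivatives is at most
`B` in absolute value, the coordinate vectors having norm `1`). [folklore] -/
theorem realKinetic_le_of_norm_fderiv_le {φ : Config N → ℝ} {X : Config N} {B : ℝ}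
    (hB : ‖fderiv ℝ φ X‖ ≤ B) : realKinetic φ X ≤ ENNReal.ofReal (3 * N * B ^ 2) := by
  rw [realKinetic_eq_ofReal]
  refine ENNReal.ofReal_le_ofReal ?_
  have hv : ∀ (i : Fin N) (k : Fin 3),
      (fderiv ℝ φ X (Pi.single i (EuclideanSpace.single k (1 : ℝ)))) ^ 2 ≤ B ^ 2 := by
    intro i k
    have hn : ‖(Pi.single i (EuclideanSpace.single k (1 : ℝ)) : Config N)‖ = 1 := by
      simp [Pi.norm_single]
    have h1 : ‖fderiv ℝ φ X (Pi.single i (EuclideanSpace.single k (1 : ℝ)))‖ ≤ B := by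
      refine (ContinuousLinearMap.le_opNorm _ _).trans ?_
      rw [hn, mul_one]
      exact hB
    rw [Real.norm_eq_abs] at h1
    exact sq_le_sq' (abs_le.1 h1).1 (abs_le.1 h1).2
  calc ∑ i, ∑ k, (fderiv ℝ φ X (Pi.single i (EuclideanSpace.single k (1 : ℝ)))) ^ 2
      ≤ ∑ _i : Fin N, ∑ _k : Fin 3, B ^ 2 :=
        Finset.sum_le_sum fun i _ => Finset.sum_le_sum fun k _ => hv i k
    _ = 3 * N * B ^ 2 := by
        simp only [Finset.sum_const, Finset.card_univ, Fintype.card_fin, nsmul_eq_mul]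
        push_cast
        ring

/-- `|∇φ(X)|² = 0` where `Dφ(X) = 0`. [folklore] -/
theorem realKinetic_eq_zero_of_fderiv {φ : Config N → ℝ} {X : Config N}
    (h : fderiv ℝ φ X = 0) : realKinetic φ X = 0 := by
  simp [realKinetic, h]

end PairCutoff

end Literature.MathematicalPhysics.QuantumManyBody.BoseGas
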